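import Literature.Geometry.DiscreteGeometry.DelsarteLinearProgrammingBound

/-!
# Rigidity of the LP-sharp code `A(7, 1/3) = 56`: inner products of a 56-point code

Framing: lottery ticket; floor = certified bounds/negative ranges. Venture `PackingBounds`
(cell `pub-packcert`), spherical-code family, STRUCTURE half of the sharp row `(7, 56, 1/3)`.

**Theorem (complementary slackness; Delsarte–Goethals–Seidel 1977 / Bannai–Sloane 1981 style).**
If `C ⊂ S^{6}` has pairwise inner products `≤ 1/3` and the maximal size `|C| = 56`, then every
inner product of two distinct points of `C` is a root of the sharp certificate
`f(t) = (t + 1) · ((t + 1 / 3) ^ 2) · (t - 1 / 3)`, i.e. lies in `{-1, -1/3, 1/3}` — the inner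
products of the 56-point E₇ code (28 equiangular lines). Proof: `56 · f_0 = f(1)` exactly, so
`Literature.Geometry.DiscreteGeometry.DelsarteLP.sum_eq_zero_of_card_mul_eq` gives `f(⟨x,y⟩) = 0`;
then factor.

## References
* P. Delsarte, J. M. Goethals, J. J. Seidel, Geom. Dedicata 6 (1977) 363–388. [`DelsarteGoethalsSeidel1977`]
* H. Cohn, A. Kumar, J. Amer. Math. Soc. 20 (2007) 99–148, Table 1. [`CohnKumar2006`]
-/

namespace Summit.Ventures.PackingBounds.SphericalCodes

open Finset Literature.Analysis.SpecialFunctions Literature.Geometry.DiscreteGeometry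

/-- **Inner products of a maximal (56-point) code in `ℝ^7` with `⟨x,y⟩ ≤ 1/3`** lie in
`{-1, -1/3, 1/3}` (the 56-point E₇ code (28 equiangular lines)). [cite: CohnKumar2006, Table 1] -/
theorem code_dim7_inner_of_card_eq_56 (C : Finset (EuclideanSpace ℝ (Fin 7)))
    (h1 : ∀ x ∈ C, ‖x‖ = 1) (h2 : ∀ x ∈ C, ∀ y ∈ C, x ≠ y → inner ℝ x y ≤ 1 / 3)
    (hcard : C.card = 56) {x y : EuclideanSpace ℝ (Fin 7)} (hx : x ∈ C) (hy : y ∈ C) (hxy : x ≠ y) :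
    inner ℝ x y = -1 ∨
      inner ℝ x y = -1 / 3 ∨
      inner ℝ x y = 1 / 3 := by
  have hpoly : ∀ t : ℝ, ∑ k ∈ range (4 + 1),
      (fun k => match k with
      | 0 => 8 / 189 | 1 => 8 / 135 | 2 => 152 / 3465 | 3 => 8 / 315 | 4 => 8 / 1155 | _ => 0) k * gegenbauerSum ((5 / 2) : ℝ) k t =
      (t + 1) * ((t + 1 / 3) ^ 2) * (t - 1 / 3) := by
    intro t
    simp [Finset.sum_range_succ, gegenbauerSum, gegenbauerCoeff, Finset.prod_range_succ,
      Nat.factorial]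
    ring
  have h0 := DelsarteLP.sum_eq_zero_of_card_mul_eq (n := 7) (μ := (5 / 2)) (by norm_num) (by norm_num) 4
    (fun k => match k with
      | 0 => 8 / 189 | 1 => 8 / 135 | 2 => 152 / 3465 | 3 => 8 / 315 | 4 => 8 / 1155 | _ => 0)
    ?_ (1 / 3) ?_ C h1 h2 ?_ hx hy hxy
  · rw [hpoly] at h0
    set t : ℝ := inner ℝ x y with ht
    clear_value t
    have hz : (t + 1) * ((t + 1 / 3) ^ 2) * (t - 1 / 3) = 0 := h0
    simp only [mul_eq_zero, pow_eq_zero_iff, ne_eq, OfNat.ofNat_ne_zero, not_false_eq_true] at hz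
    rcases hz with (hm1 | hq1) | hs
    · left; linarith
    · right; left; linarith
    · right; right; linarith
  · intro k
    split <;> norm_num
  · intro t ht1 ht2
    rw [hpoly]
    exact mul_nonpos_of_nonneg_of_nonpos (mul_nonneg (by linarith) (by positivity)) (by linarith)
  · rw [hcard]
    norm_num [Finset.sum_range_succ, gegenbauerSum, gegenbauerCoeff, Finset.prod_range_succ,
      Nat.factorial]

end Summit.Ventures.PackingBounds.SphericalCodes
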